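import Mathlib
import Summits.NavierStokesRegularity.NavierStokesRegularity.Theorems.FilamentSkeletonRssDefectColumnGateQuasimodeBound
import Summits.NavierStokesRegularity.NavierStokesRegularity.Theorems.FilamentSkeletonRssDefectColumnGateFarFieldFields

/-!
# Route `FilamentSkeletonRss` · crux `TransverseReduction1AG` (stmt-NavierStokesRegularity-27853) · line `defect_column_gate_1AG` —
# THE FAR-FIELD QUASIMODES EXIST (`farFieldQuasimodes1A`) AND THE GLOBAL SECTIONAL GATE S2a IS FALSE (`not_waistColumnGate1A`)

Helper file (`--supports stmt-NavierStokesRegularity-27853 --as helper`; LEAD of 27853, lane ns-filament-21221-p1 g10).  Assembly of the owed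
construction `FarFieldQuasimodes1A` (tree `…DefectColumnGateWaistQuasimodes`) from the landed pieces: the witness `B₀ = diag(1/5, −3/10, 8/5)`, `κ = 8/5`
(`…QuasimodeWitness`), the stream-function fields `W_L = c₀·∇Ψ_L × e₃`, `Ψ_L = F₀(y₀)E(y₁)` (C³, solenoidal, finite sectional size, all three sectional
vorticity moments zero by `…Moments`), the pointwise estimate `⟨ξ⟩⁴|colForceVort B₀ 0 gam Rc e₃ W_L| ≤ K/L` (`…QuasimodeBound`) and the lower bound
`⟨ξ⟩⁴|curl W_L| ≥ 1` at `y* = e^{3L/2}e₁` for `L` large.  Consequence: `not_waistColumnGate1A : ¬ WaistColumnGate1A` — the kernel-certified form of the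
LEAD's `stub-false S2a` finding (memo S2A-FALSE-FARFIELD-27853-g10.md); the line of record was reshaped to the LOCALISED gate `WaistColumnGateLoc1A` (Defs §7).
HONEST FRAMING: this refutes ONE over-strong MODEL stub of one line; it says nothing about `TransverseReduction1AG`, the route, or Navier–Stokes
regularity (MODEL rung, negative side).
-/

set_option linter.dupNamespace false

noncomputable section

namespace Summit.NavierStokesRegularity.NavierStokesRegularity.Theorems.DefectColumnGate

open scoped BigOperators Topology InnerProductSpace ContDiff
open Set Function Filter MeasureTheory WithLp
open Literature.Analysis.FluidPDE
open Summit.NavierStokesRegularity.NavierStokesRegularity.Theorems.KelvinGate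

/-! ## 3. Finite sectional size -/

/-- `(1+x²)²|F_k(x)| ≤ 4M_k` everywhere (`L ≥ 1`). -/
theorem weight_farProfile_abs_le {L M : ℝ} {k : ℕ} (hL : 1 ≤ L) (hM : ∀ z, |z| ^ (4 + k) * |farProfile L k z| ≤ M) (x : ℝ) :
    (1 + x ^ 2) ^ 2 * |farProfile L k x| ≤ 4 * M := by
  have hM0 : 0 ≤ M := le_trans (by positivity) (hM 0)
  by_cases hx : |x| ≤ Real.exp L
  · rw [farProfile_eq_zero_of_abs_le (by linarith) k hx, abs_zero, mul_zero]; positivity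
  · have hx1 : 1 ≤ |x| := le_trans (Real.one_le_exp (by linarith)) (not_le.1 hx).le
    have h1k : (1:ℝ) ≤ |x| ^ k := one_le_pow₀ hx1
    calc (1 + x ^ 2) ^ 2 * |farProfile L k x| = (1 + x ^ 2) ^ 2 * 1 * |farProfile L k x| := by rw [mul_one]
      _ ≤ (1 + x ^ 2) ^ 2 * |x| ^ k * |farProfile L k x| :=
          mul_le_mul_of_nonneg_right (mul_le_mul_of_nonneg_left h1k (by positivity)) (abs_nonneg _)
      _ ≤ 4 * M := weight_farProfile_le' hM hx1

/-- `(1+v²)²|E(v)| ≤ CE`. -/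
theorem weight_gaussE_le (v : ℝ) : (1 + v ^ 2) ^ 2 * |gaussE lamW v| ≤ CE := by
  have h := wy_pow_le (j := 0) (Nat.zero_le _) v
  rw [pow_zero, one_mul] at h
  rwa [abs_of_pos (gaussE_pos lamW v)]

/-- `(1+v²)²|E′(v)| ≤ λ₂·CE`. -/
theorem weight_deriv_gaussE_le (v : ℝ) : (1 + v ^ 2) ^ 2 * |-(lamW * v) * gaussE lamW v| ≤ lamW * CE := by
  have h := wy_pow_le (j := 1) (by norm_num) v
  have hE := gaussE_pos lamW v
  rw [show |-(lamW * v) * gaussE lamW v| = lamW * (|v| ^ 1 * gaussE lamW v) by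
    rw [abs_mul, abs_neg, abs_mul, abs_of_pos lamW_pos, abs_of_pos hE, pow_one]; ring]
  calc (1 + v ^ 2) ^ 2 * (lamW * (|v| ^ 1 * gaussE lamW v)) = lamW * ((1 + v ^ 2) ^ 2 * (|v| ^ 1 * gaussE lamW v)) := by ring
    _ ≤ lamW * CE := mul_le_mul_of_nonneg_left h lamW_pos.le

/-- `(1+v²)²|p₂E(v)| ≤ C_q`. -/
theorem weight_p2_gaussE_le (v : ℝ) :
    (1 + v ^ 2) ^ 2 * |(lamW ^ 2 * v ^ 2 - lamW) * gaussE lamW v| ≤ (|-lamW| + |(0:ℝ)| + |lamW ^ 2| + |(0:ℝ)|) * CE := by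
  rw [show (lamW ^ 2 * v ^ 2 - lamW) = (-lamW + 0 * v + lamW ^ 2 * v ^ 2 + 0 * v ^ 3) by ring]
  exact wy_poly_le _ _ _ _ v

/-- `1 + a + b ≤ (1+a)²(1+b)²` for `a, b ≥ 0`. -/
theorem weight_one_le {a b : ℝ} (ha : 0 ≤ a) (hb : 0 ≤ b) : 1 + a + b ≤ (1 + a) ^ 2 * (1 + b) ^ 2 := by
  have hp : 1 ≤ (1 + a) * (1 + b) := by nlinarith [mul_nonneg ha hb]
  calc 1 + a + b ≤ (1 + a) * (1 + b) := by nlinarith [mul_nonneg ha hb]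
    _ ≤ ((1 + a) * (1 + b)) ^ 2 := le_self_pow₀ hp two_ne_zero
    _ = (1 + a) ^ 2 * (1 + b) ^ 2 := by ring

/-- **Finite sectional size of `c·W_L`** (`L ≥ 1`): `⟨ξ⟩²|cW_L| ≤ A` and `⟨ξ⟩⁴|curl(cW_L)| ≤ A`. -/
theorem size_smul_farW {L : ℝ} (hL1 : 1 ≤ L) (c : ℝ) :
    ∃ A : ℝ, ∀ y : EuclideanSpace ℝ (Fin 3),
      secWt (EuclideanSpace.single 2 1) y * ‖c • farW L y‖ ≤ A ∧
      secWt (EuclideanSpace.single 2 1) y ^ 2 * ‖curl (fun z => c • farW L z) y‖ ≤ A := by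
  have hL : 0 < L := by linarith
  obtain ⟨M0, hM0⟩ := exists_bound_farProfile 0
  obtain ⟨M1, hM1⟩ := exists_bound_farProfile 1
  obtain ⟨M2, hM2⟩ := exists_bound_farProfile 2
  have hM0p : 0 ≤ M0 := le_trans (by positivity) (hM0 1 le_rfl 0)
  have hM1p : 0 ≤ M1 := le_trans (by positivity) (hM1 1 le_rfl 0)
  have hM2p : 0 ≤ M2 := le_trans (by positivity) (hM2 1 le_rfl 0)
  have hCq : 0 ≤ (|-lamW| + |(0:ℝ)| + |lamW ^ 2| + |(0:ℝ)|) * CE := mul_nonneg (by positivity) CE_nonneg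
  have hCE := CE_nonneg
  have hlam := lamW_pos.le
  refine ⟨|c| * (4 * M0 * (lamW * CE) + 4 * M1 * CE + 4 * M2 * CE + 4 * M0 * ((|-lamW| + |(0:ℝ)| + |lamW ^ 2| + |(0:ℝ)|) * CE)),
    fun y => ⟨?_, ?_⟩⟩
  · have hwx0 := weight_farProfile_abs_le hL1 (hM0 L hL1) (y 0)
    have hwx1 := weight_farProfile_abs_le hL1 (hM1 L hL1) (y 0)
    have hwE' := weight_deriv_gaussE_le (y 1)
    have hwE := weight_gaussE_le (y 1)
    have hnorm : ‖c • farW L y‖ ≤ |c| * (|farProfile L 0 (y 0)| * |-(lamW * y 1) * gaussE lamW (y 1)|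
        + |farProfile L 1 (y 0)| * |gaussE lamW (y 1)|) := by
      rw [farW_apply hL y, norm_smul, Real.norm_eq_abs]
      refine mul_le_mul_of_nonneg_left ((norm_sub_le _ _).trans (le_of_eq ?_)) (abs_nonneg c)
      simp only [norm_smul_single_one, abs_mul]
    have hwt : secWt (EuclideanSpace.single 2 1) y ≤ (1 + y 0 ^ 2) ^ 2 * (1 + y 1 ^ 2) ^ 2 := by
      rw [secWt_e3]; exact weight_one_le (sq_nonneg _) (sq_nonneg _)
    calc secWt (EuclideanSpace.single 2 1) y * ‖c • farW L y‖
        ≤ ((1 + y 0 ^ 2) ^ 2 * (1 + y 1 ^ 2) ^ 2) * (|c| * (|farProfile L 0 (y 0)| * |-(lamW * y 1) * gaussE lamW (y 1)|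
            + |farProfile L 1 (y 0)| * |gaussE lamW (y 1)|)) := mul_le_mul hwt hnorm (norm_nonneg _) (by positivity)
      _ = |c| * (((1 + y 0 ^ 2) ^ 2 * |farProfile L 0 (y 0)|) * ((1 + y 1 ^ 2) ^ 2 * |-(lamW * y 1) * gaussE lamW (y 1)|)
            + ((1 + y 0 ^ 2) ^ 2 * |farProfile L 1 (y 0)|) * ((1 + y 1 ^ 2) ^ 2 * |gaussE lamW (y 1)|)) := by ring
      _ ≤ |c| * (4 * M0 * (lamW * CE) + 4 * M1 * CE) :=
          mul_le_mul_of_nonneg_left (add_le_add (mul_le_mul hwx0 hwE' (by positivity) (by positivity))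
            (mul_le_mul hwx1 hwE (by positivity) (by positivity))) (abs_nonneg c)
      _ ≤ _ := by
          refine mul_le_mul_of_nonneg_left ?_ (abs_nonneg c)
          have h5 : 0 ≤ M2 * CE := mul_nonneg hM2p hCE
          have h6 : 0 ≤ M0 * ((|-lamW| + |(0:ℝ)| + |lamW ^ 2| + |(0:ℝ)|) * CE) := mul_nonneg hM0p hCq
          linarith
  · have hwx0 := weight_farProfile_abs_le hL1 (hM0 L hL1) (y 0)
    have hwx2 := weight_farProfile_abs_le hL1 (hM2 L hL1) (y 0)
    have hwE := weight_gaussE_le (y 1)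
    have hwq := weight_p2_gaussE_le (y 1)
    have hnorm : ‖curl (fun z => c • farW L z) y‖ ≤ |c| * (|farProfile L 2 (y 0)| * |gaussE lamW (y 1)|
        + |farProfile L 0 (y 0)| * |(lamW ^ 2 * y 1 ^ 2 - lamW) * gaussE lamW (y 1)|) := by
      rw [curl_smul_farW hL c y, norm_smul_single_one, abs_mul, abs_neg]
      refine mul_le_mul_of_nonneg_left ((abs_add_le _ _).trans (le_of_eq ?_)) (abs_nonneg c)
      simp only [abs_mul]
    have hwt : secWt (EuclideanSpace.single 2 1) y ^ 2 ≤ (1 + y 0 ^ 2) ^ 2 * (1 + y 1 ^ 2) ^ 2 := by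
      rw [secWt_e3]; exact weight_split (sq_nonneg _) (sq_nonneg _)
    calc secWt (EuclideanSpace.single 2 1) y ^ 2 * ‖curl (fun z => c • farW L z) y‖
        ≤ ((1 + y 0 ^ 2) ^ 2 * (1 + y 1 ^ 2) ^ 2) * (|c| * (|farProfile L 2 (y 0)| * |gaussE lamW (y 1)|
            + |farProfile L 0 (y 0)| * |(lamW ^ 2 * y 1 ^ 2 - lamW) * gaussE lamW (y 1)|)) :=
          mul_le_mul hwt hnorm (norm_nonneg _) (by positivity)
      _ = |c| * (((1 + y 0 ^ 2) ^ 2 * |farProfile L 2 (y 0)|) * ((1 + y 1 ^ 2) ^ 2 * |gaussE lamW (y 1)|)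
            + ((1 + y 0 ^ 2) ^ 2 * |farProfile L 0 (y 0)|) * ((1 + y 1 ^ 2) ^ 2 * |(lamW ^ 2 * y 1 ^ 2 - lamW) * gaussE lamW (y 1)|)) := by
          ring
      _ ≤ |c| * (4 * M2 * CE + 4 * M0 * ((|-lamW| + |(0:ℝ)| + |lamW ^ 2| + |(0:ℝ)|) * CE)) :=
          mul_le_mul_of_nonneg_left (add_le_add (mul_le_mul hwx2 hwE (by positivity) (by positivity))
            (mul_le_mul hwx0 hwq (by positivity) (by positivity))) (abs_nonneg c)
      _ ≤ _ := by
          refine mul_le_mul_of_nonneg_left ?_ (abs_nonneg c)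
          have h5 : 0 ≤ M0 * (lamW * CE) := mul_nonneg hM0p (mul_nonneg hlam hCE)
          have h6 : 0 ≤ M1 * CE := mul_nonneg hM1p hCE
          linarith

/-! ## 4. The lower bound at `y* = e^{3L/2}·e₁` -/

/-- `F₀(e^{3L/2}) = χ₀(3/2)·e^{−6L}`: the bump is evaluated at its interior point `3/2`. -/
theorem farProfile_zero_at_peak {L : ℝ} (hL : 0 < L) :
    farProfile L 0 (Real.exp (3 * L / 2)) = bump12 (3/2) * (Real.exp (3 * L / 2) ^ 4)⁻¹ := by
  rw [farProfile, farShape, Real.log_exp, add_zero]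
  congr 2
  field_simp

/-- **Lower bound.**  With `c₁ = λ₂χ₀(3/2)`, `c₀ = 2/c₁` and `M₂/c₁ ≤ L`, `L ≥ 1`: `⟨ξ⟩⁴·|curl(c₀W_L)(y*)| ≥ 1` at `y* = e^{3L/2}e₁`. -/
theorem lower_bound_smul_farW {L M2 : ℝ} (hL1 : 1 ≤ L) (hM2 : ∀ z, |z| ^ (4 + 2) * |farProfile L 2 z| ≤ M2)
    (hLM : M2 / (lamW * bump12 (3/2)) ≤ L) :
    1 ≤ secWt (EuclideanSpace.single 2 1) (EuclideanSpace.single 0 (Real.exp (3 * L / 2)) : EuclideanSpace ℝ (Fin 3)) ^ 2 *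
      ‖curl (fun z => (2 / (lamW * bump12 (3/2))) • farW L z) (EuclideanSpace.single 0 (Real.exp (3 * L / 2)))‖ := by
  have hL : 0 < L := by linarith
  have hb : 0 < bump12 (3/2) := bump12_pos (by norm_num) (by norm_num)
  have hc₁ : 0 < lamW * bump12 (3/2) := mul_pos lamW_pos hb
  have hM2p : 0 ≤ M2 := le_trans (by positivity) (hM2 0)
  set x : ℝ := Real.exp (3 * L / 2) with hxdef
  have hx : 0 < x := Real.exp_pos _
  have hx2 : x ^ 2 = Real.exp (3 * L) := by rw [hxdef, ← Real.exp_nat_mul]; congr 1; ring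
  -- the axial vorticity at y*
  have h0 : (EuclideanSpace.single 0 x : EuclideanSpace ℝ (Fin 3)) 0 = x := by simp
  have h1 : (EuclideanSpace.single 0 x : EuclideanSpace ℝ (Fin 3)) 1 = 0 := by simp
  have hE0 : gaussE lamW 0 = 1 := by simp [gaussE]
  rw [curl_smul_farW hL, h0, h1, hE0, norm_smul_single_one, secWt_e3, h0, h1]
  have hF0 : x ^ 4 * farProfile L 0 x = bump12 (3/2) := by
    rw [hxdef, farProfile_zero_at_peak hL]; field_simp
  have hF2 : x ^ 2 * (x ^ 4 * |farProfile L 2 x|) ≤ M2 := by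
    have h := hM2 x
    rw [abs_of_pos hx] at h
    calc x ^ 2 * (x ^ 4 * |farProfile L 2 x|) = x ^ (4 + 2) * |farProfile L 2 x| := by ring
      _ ≤ M2 := h
  -- `x² ≥ 1 + 3L ≥ 2M₂/c₁`
  have hxL : 2 * M2 ≤ (lamW * bump12 (3/2)) * x ^ 2 := by
    have h3 : 3 * L + 1 ≤ x ^ 2 := by rw [hx2]; exact Real.add_one_le_exp _
    have hM : M2 ≤ (lamW * bump12 (3/2)) * L := by rwa [div_le_iff₀ hc₁, mul_comm] at hLM
    nlinarith
  have hsmall : x ^ 4 * |farProfile L 2 x| ≤ (lamW * bump12 (3/2)) / 2 := by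
    by_contra hcon
    rw [not_le] at hcon
    have h := mul_lt_mul_of_pos_left hcon (pow_pos hx 2)
    linarith
  -- `t = λ₂F₀ − |F₂|`, `x⁴ t ≥ c₁/2`
  have ht : (lamW * bump12 (3/2)) / 2 ≤ x ^ 4 * (lamW * farProfile L 0 x - |farProfile L 2 x|) := by
    have e : x ^ 4 * (lamW * farProfile L 0 x - |farProfile L 2 x|) = lamW * (x ^ 4 * farProfile L 0 x) - x ^ 4 * |farProfile L 2 x| := by ring
    rw [e, hF0]; linarith
  have htpos : 0 < lamW * farProfile L 0 x - |farProfile L 2 x| := by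
    by_contra hcon
    rw [not_lt] at hcon
    have : x ^ 4 * (lamW * farProfile L 0 x - |farProfile L 2 x|) ≤ 0 := mul_nonpos_of_nonneg_of_nonpos (by positivity) hcon
    linarith
  have hc₀ : 0 < 2 / (lamW * bump12 (3/2)) := div_pos two_pos hc₁
  have htabs : lamW * farProfile L 0 x - |farProfile L 2 x| ≤ |lamW * farProfile L 0 x - farProfile L 2 x| := by
    linarith [le_abs_self (farProfile L 2 x), le_abs_self (lamW * farProfile L 0 x - farProfile L 2 x)]
  have e : |2 / (lamW * bump12 (3/2)) * -(farProfile L 2 x * 1 + farProfile L 0 x * ((lamW ^ 2 * (0:ℝ) ^ 2 - lamW) * 1))|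
      = 2 / (lamW * bump12 (3/2)) * |lamW * farProfile L 0 x - farProfile L 2 x| := by
    rw [abs_mul, abs_of_pos hc₀,
      show -(farProfile L 2 x * 1 + farProfile L 0 x * ((lamW ^ 2 * (0:ℝ) ^ 2 - lamW) * 1)) = lamW * farProfile L 0 x - farProfile L 2 x by ring]
  have hw : x ^ 4 ≤ (1 + x ^ 2 + (0:ℝ) ^ 2) ^ 2 := by nlinarith [sq_nonneg x]
  have hne : lamW * bump12 (3/2) ≠ 0 := hc₁.ne'
  rw [e]
  calc (1:ℝ) = 2 / (lamW * bump12 (3/2)) * ((lamW * bump12 (3/2)) / 2) := by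
        rw [div_mul_div_comm, mul_comm (2:ℝ) (lamW * bump12 (3/2)), div_self (mul_ne_zero hne two_ne_zero)]
    _ ≤ 2 / (lamW * bump12 (3/2)) * (x ^ 4 * (lamW * farProfile L 0 x - |farProfile L 2 x|)) :=
        mul_le_mul_of_nonneg_left ht hc₀.le
    _ = x ^ 4 * (2 / (lamW * bump12 (3/2)) * (lamW * farProfile L 0 x - |farProfile L 2 x|)) := by ring
    _ ≤ (1 + x ^ 2 + (0:ℝ) ^ 2) ^ 2 * (2 / (lamW * bump12 (3/2)) * |lamW * farProfile L 0 x - farProfile L 2 x|) :=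
        mul_le_mul hw (mul_le_mul_of_nonneg_left htabs hc₀.le) (mul_nonneg hc₀.le htpos.le) (by positivity)

/-! ## 5. Assembly -/

/-- **THE FAR-FIELD QUASIMODES EXIST** (owed construction of `…WaistQuasimodes`, now discharged): witness `B₀ = diag(1/5, −3/10, 8/5)`, `κ = 8/5`,
`W = c₀·∇Ψ_L × e₃` with `L = 1 + c₀K/ε + M₂/c₁`. -/
theorem farFieldQuasimodes1A : FarFieldQuasimodes1A := by
  refine ⟨waistB0, 8/5, ⟨by norm_num, by norm_num, waistB0_single_two, waistB0_trace, norm_waistB0_le⟩, ?_⟩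
  intro Rc hRc ε hε
  obtain ⟨K, hK, hest⟩ := quasimode_estimate (le_trans zero_le_one hRc)
  obtain ⟨M2, hM2⟩ := exists_bound_farProfile 2
  have hM2p : 0 ≤ M2 := le_trans (by positivity) (hM2 1 le_rfl 0)
  have hb : 0 < bump12 (3/2) := bump12_pos (by norm_num) (by norm_num)
  have hc₁ : 0 < lamW * bump12 (3/2) := mul_pos lamW_pos hb
  have hc₀ : 0 < 2 / (lamW * bump12 (3/2)) := div_pos two_pos hc₁
  set L : ℝ := 1 + 2 / (lamW * bump12 (3/2)) * K / ε + M2 / (lamW * bump12 (3/2)) with hLdef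
  have hKε : 0 ≤ 2 / (lamW * bump12 (3/2)) * K / ε := by positivity
  have hMc : 0 ≤ M2 / (lamW * bump12 (3/2)) := by positivity
  have hL1 : 1 ≤ L := by linarith
  have hL : 0 < L := by linarith
  have hLK : 2 / (lamW * bump12 (3/2)) * K / ε ≤ L := by linarith
  have hLM : M2 / (lamW * bump12 (3/2)) ≤ L := by linarith
  refine ⟨fun z => (2 / (lamW * bump12 (3/2))) • farW L z, (contDiff_farW hL).const_smul _, ?_, size_smul_farW hL1 _,
    fun τ => moments_smul_farW hL _ τ, ?_, ⟨EuclideanSpace.single 0 (Real.exp (3 * L / 2)), lower_bound_smul_farW hL1 (hM2 L hL1) hLM⟩⟩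
  · intro y
    rw [divergence_const_smul_apply (((contDiff_farW hL).differentiable (by norm_num)) y), isDivFree_farW hL y, mul_zero]
  · intro y
    rw [colForceVort_const_smul waistB0 0 (8/5 - 3/2) Rc _ (EuclideanSpace.single 2 1) (contDiff_farW hL) y, norm_smul,
      Real.norm_eq_abs, abs_of_pos hc₀]
    have h := hest L hL1 y
    have hne : lamW * bump12 (3/2) ≠ 0 := hc₁.ne'
    have hKL : 2 / (lamW * bump12 (3/2)) * (K / L) ≤ ε := by
      rw [← mul_div_assoc, div_le_iff₀ hL]
      calc 2 / (lamW * bump12 (3/2)) * K = (2 / (lamW * bump12 (3/2)) * K / ε) * ε := by field_simp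
        _ ≤ L * ε := mul_le_mul_of_nonneg_right hLK hε.le
        _ = ε * L := mul_comm _ _
    calc secWt (EuclideanSpace.single 2 1) y ^ 2 *
          (2 / (lamW * bump12 (3/2)) * ‖colForceVort waistB0 0 (8/5 - 3/2) Rc (EuclideanSpace.single 2 1) (farW L) y‖)
        = 2 / (lamW * bump12 (3/2)) *
          (secWt (EuclideanSpace.single 2 1) y ^ 2 * ‖colForceVort waistB0 0 (8/5 - 3/2) Rc (EuclideanSpace.single 2 1) (farW L) y‖) := by ring
      _ ≤ 2 / (lamW * bump12 (3/2)) * (K / L) := mul_le_mul_of_nonneg_left h hc₀.le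
      _ ≤ ε := hKL

/-- **THE GLOBAL SECTIONAL GATE S2a IS FALSE**: `¬ WaistColumnGate1A` (kernel-certified `stub-false`; the line of record uses the localised gate
`WaistColumnGateLoc1A` instead).  MODEL rung, negative side; no bearing on `TransverseReduction1AG` or on Navier–Stokes regularity. -/
theorem not_waistColumnGate1A : ¬ WaistColumnGate1A :=
  not_waistColumnGate1A_of_farFieldQuasimodes farFieldQuasimodes1A

end Summit.NavierStokesRegularity.NavierStokesRegularity.Theorems.DefectColumnGate

end
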